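import Literature.NumberTheory.EllipticCurves.IwasawaAlgebraCompactNakayamaProofs
import Mathlib.RingTheory.Ideal.Operations
import Mathlib.Algebra.Module.Submodule.Pointwise
import HarnessLib

/-!
# Compact Nakayama over the two-variable Iwasawa algebra `Λ₂ = ℤ_p⟦T₂⟧⟦T₁⟧`, separated form: a
# `Λ₂`-module `M` with `⋂_k 𝔪^k M = 0` (`𝔪 = (p, T₁, T₂)`) and `M = ⟨s⟩_{Λ₂} + 𝔪M` for a finite `s` is
# generated by `s`

Topic `NumberTheory/EllipticCurves` (namespace = path; next to the one-variable file
`IwasawaAlgebraCompactNakayamaProofs.lean`, whose argument this file repeats coefficientwise in two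
variables). Cell `bsd-print-cf2` (HOME `run/shared/lean/pub/bsd-print-cf2/`), width seat
`bsd-line-cf2c-w3` g12. `Proofs`-style file: theorems only (no definition, no named fact, no `sorry`,
no instance).

## Statement and proof

Topological Nakayama for compact modules over the local ring `Λ₂ = ℤ_p⟦T₁, T₂⟧`
([NSW 2008, (5.2.18)]: "`X` a compact `Λ`-module … `X/𝔪X` finitely generated ⟹ `X` finitely
generated"; [Washington 1997, Lemma 13.16] in one variable) WITHOUT a topology on `M`, in the form the
tree's pinned inverse-limit data supply: `M` is **`𝔪`-adically separated** — an element of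
`⋂_k 𝔪^k M` is `0`, `𝔪 = (p, T₁, T₂)` (here `T₁ = PowerSeries.X`, `T₂ = C PowerSeries.X`,
`p = C (C p)`) — and **`⟨s⟩_{Λ₂} + 𝔪M = M`** for a finite set `s`. Conclusion: `⟨s⟩_{Λ₂} = M`
(`span_eq_top_of_separated_of_span_sup_smul_top_eq_top₂`), so `M` is a finitely generated `Λ₂`-module
(`module_finite_of_separated_of_span_sup_smul_top_eq_top₂`).
Proof: `M = ⟨s⟩ + 𝔪^k M` for all `k` (iteration); for `x ∈ M` the sets
`D_k = {c ∈ (ℤ_p^{ℕ×ℕ})^s : x − Σ_i (Σ_{j,l} c_{ijl} T₁^j T₂^l) s_i ∈ 𝔪^k M}` of COEFFICIENT families are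
non-empty, decreasing, and closed in the compact product topology (membership depends only on the
`c_{ijl} mod p^k`, `j, l < k`, because a double power series whose coefficients of bidegree `< (k,k)`
are divisible by `p^k` lies in `(T₁^k, T₂^k, p^k) ⊆ 𝔪^k`: `mk₂_mem_pow_of_norm_le`), so they share a
point `c`, and `x − Σ_i (…) s_i ∈ ⋂_k 𝔪^k M = 0`. Intended consumer: finite generation of Rubin's
`U_∞/𝒞̄_∞` along a `ℤ_p²`-tower at `p = 2` (cell bsd-print-cf2, `stub_unitsQuotient`), whose pinned
datum is an inverse limit of finite `𝔪`-nilpotent layers (separated) — reducing it to the finiteness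
of `M/𝔪M`.

## References

* J. Neukirch, A. Schmidt, K. Wingberg, *Cohomology of Number Fields*, 2nd ed. (2008), (5.2.18).
  [NeukirchSchmidtWingberg2008]
* L. C. Washington, *Introduction to Cyclotomic Fields*, 2nd ed., GTM 83 (1997), Lemma 13.16.
  [Washington1997]
-/

noncomputable section

namespace Literature.NumberTheory.EllipticCurves

open scoped Pointwise

variable {p : ℕ} [Fact p.Prime]

/-! ## The maximal ideal `𝔪 = (p, T₁, T₂)` of `Λ₂` and double power series -/

/-- The coefficient in bidegree `(j, l)` (`T₁^j T₂^l`) of a double power series. [folklore] -/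
private theorem coeff_coeff_mk_mk (d : ℕ → ℕ → ℤ_[p]) (j l : ℕ) :
    PowerSeries.coeff l (PowerSeries.coeff j
      (PowerSeries.mk fun j ↦ (PowerSeries.mk (d j) : IwasawaAlgebra p))) = d j l := by
  rw [PowerSeries.coeff_mk, PowerSeries.coeff_mk]

/-- A double power series whose coefficients of bidegree `< (k, k)` are divisible by `p^k` lies in the
ideal `(T₁^k, T₂^k, p^k)`: `Σ d_{jl} T₁^j T₂^l = T₁^k·g + T₂^k·h + p^k·r`. [folklore] -/
private theorem mk₂_eq_of_norm_le (k : ℕ) {d : ℕ → ℕ → ℤ_[p]}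
    (hd : ∀ j l, j < k → l < k → ‖d j l‖ ≤ (p : ℝ) ^ (-(k : ℤ))) :
    ∃ g h r : PowerSeries (IwasawaAlgebra p),
      (PowerSeries.mk fun j ↦ (PowerSeries.mk (d j) : IwasawaAlgebra p)) =
        (PowerSeries.X : PowerSeries (IwasawaAlgebra p)) ^ k * g +
          PowerSeries.C ((PowerSeries.X : IwasawaAlgebra p) ^ k) * h +
            PowerSeries.C (PowerSeries.C ((p : ℤ_[p]) ^ k)) * r := by
  classical
  have hdiv : ∀ j l, j < k → l < k → ∃ e : ℤ_[p], e * (p : ℤ_[p]) ^ k = d j l := fun j l hj hl ↦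
    Ideal.mem_span_singleton'.mp ((PadicInt.norm_le_pow_iff_mem_span_pow _ _).mp (hd j l hj hl))
  choose! e he using hdiv
  refine ⟨PowerSeries.mk fun j ↦ (PowerSeries.mk (d (j + k)) : IwasawaAlgebra p),
    PowerSeries.mk fun j ↦ if j < k then (PowerSeries.mk fun l ↦ d j (l + k) : IwasawaAlgebra p) else 0,
    PowerSeries.mk fun j ↦ if j < k then (PowerSeries.mk fun l ↦ if l < k then e j l else 0 : IwasawaAlgebra p)
      else 0, ?_⟩
  refine PowerSeries.ext fun j ↦ ?_
  by_cases hj : j < k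
  · simp only [map_add, PowerSeries.coeff_X_pow_mul', PowerSeries.coeff_C_mul, PowerSeries.coeff_mk,
      if_neg (not_le.mpr hj), if_pos hj, zero_add]
    refine PowerSeries.ext fun l ↦ ?_
    by_cases hl : l < k
    · simp only [map_add, PowerSeries.coeff_X_pow_mul', PowerSeries.coeff_C_mul, PowerSeries.coeff_mk,
        if_neg (not_le.mpr hl), if_pos hl, zero_add]
      rw [mul_comm, he j l hj hl]
    · simp only [map_add, PowerSeries.coeff_X_pow_mul', PowerSeries.coeff_C_mul, PowerSeries.coeff_mk,
        if_pos (not_lt.mp hl), if_neg hl, mul_zero, add_zero, Nat.sub_add_cancel (not_lt.mp hl)]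
  · simp only [map_add, PowerSeries.coeff_X_pow_mul', PowerSeries.coeff_C_mul, PowerSeries.coeff_mk,
      if_pos (not_lt.mp hj), if_neg hj, mul_zero, add_zero, Nat.sub_add_cancel (not_lt.mp hj)]

/-- `T₁^k`, `T₂^k` and `p^k` lie in `𝔪^k` for `𝔪 = (p, T₁, T₂)`. [folklore] -/
private theorem pow_mem_maxIdeal_pow (k : ℕ) :
    (PowerSeries.X : PowerSeries (IwasawaAlgebra p)) ^ k ∈
        (Ideal.span {PowerSeries.C (PowerSeries.C (p : ℤ_[p])), (PowerSeries.X : PowerSeries (IwasawaAlgebra p)),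
          PowerSeries.C (PowerSeries.X : IwasawaAlgebra p)} : Ideal (PowerSeries (IwasawaAlgebra p))) ^ k ∧
      PowerSeries.C ((PowerSeries.X : IwasawaAlgebra p) ^ k) ∈
        (Ideal.span {PowerSeries.C (PowerSeries.C (p : ℤ_[p])), (PowerSeries.X : PowerSeries (IwasawaAlgebra p)),
          PowerSeries.C (PowerSeries.X : IwasawaAlgebra p)} : Ideal (PowerSeries (IwasawaAlgebra p))) ^ k ∧
      PowerSeries.C (PowerSeries.C ((p : ℤ_[p]) ^ k)) ∈
        (Ideal.span {PowerSeries.C (PowerSeries.C (p : ℤ_[p])), (PowerSeries.X : PowerSeries (IwasawaAlgebra p)),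
          PowerSeries.C (PowerSeries.X : IwasawaAlgebra p)} : Ideal (PowerSeries (IwasawaAlgebra p))) ^ k := by
  refine ⟨Ideal.pow_mem_pow (Ideal.subset_span (by simp)) k, ?_, ?_⟩
  · rw [map_pow]
    exact Ideal.pow_mem_pow (Ideal.subset_span (by simp)) k
  · rw [map_pow, map_pow]
    exact Ideal.pow_mem_pow (Ideal.subset_span (by simp)) k

variable {M : Type*} [AddCommGroup M] [Module (PowerSeries (IwasawaAlgebra p)) M]

/-- Two coefficient families congruent modulo `p^k` in bidegrees `< (k, k)` give combinations congruent
modulo `𝔪^k M`. [folklore] -/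
private theorem sum_mk₂_sub_sum_mk₂_mem {ι : Type*} [Fintype ι] (v : ι → M) (k : ℕ)
    {c c' : ι → ℕ → ℕ → ℤ_[p]} (h : ∀ i j l, j < k → l < k → ‖c i j l - c' i j l‖ ≤ (p : ℝ) ^ (-(k : ℤ))) :
    ∑ i, (PowerSeries.mk fun j ↦ (PowerSeries.mk (c i j) : IwasawaAlgebra p)) • v i -
        ∑ i, (PowerSeries.mk fun j ↦ (PowerSeries.mk (c' i j) : IwasawaAlgebra p)) • v i ∈
      (Ideal.span {PowerSeries.C (PowerSeries.C (p : ℤ_[p])), (PowerSeries.X : PowerSeries (IwasawaAlgebra p)),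
          PowerSeries.C (PowerSeries.X : IwasawaAlgebra p)} : Ideal (PowerSeries (IwasawaAlgebra p))) ^ k •
        (⊤ : Submodule (PowerSeries (IwasawaAlgebra p)) M) := by
  classical
  rw [← Finset.sum_sub_distrib]
  refine Submodule.sum_mem _ fun i _ ↦ ?_
  rw [← sub_smul]
  have hsub : (PowerSeries.mk fun j ↦ (PowerSeries.mk (c i j) : IwasawaAlgebra p)) -
      (PowerSeries.mk fun j ↦ (PowerSeries.mk (c' i j) : IwasawaAlgebra p)) =
        PowerSeries.mk fun j ↦ (PowerSeries.mk (fun l ↦ c i j l - c' i j l) : IwasawaAlgebra p) := by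
    ext j l
    simp only [map_sub, PowerSeries.coeff_mk]
  obtain ⟨g, h', r, hghr⟩ := mk₂_eq_of_norm_le (p := p) k (d := fun j l ↦ c i j l - c' i j l)
    (fun j l hj hl ↦ h i j l hj hl)
  obtain ⟨h1, h2, h3⟩ := pow_mem_maxIdeal_pow (p := p) k
  rw [hsub, hghr]
  refine Submodule.smul_mem_smul ?_ Submodule.mem_top
  exact Ideal.add_mem _ (Ideal.add_mem _ (Ideal.mul_mem_right _ _ h1) (Ideal.mul_mem_right _ _ h2))
    (Ideal.mul_mem_right _ _ h3)

/-- **`⟨s⟩ + 𝔪M = M` iterates to `⟨s⟩ + 𝔪^k M = M`** (any ideal `𝔪`, any submodule in place of `⟨s⟩`) — the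
first step of the proof of Nakayama's lemma for compact modules. [cite: Washington1997, Lemma 13.16 (proof)]
[cite: NeukirchSchmidtWingberg2008, (5.2.18) (proof)] -/
theorem sup_pow_smul_top_eq_top_of_sup_smul_top_eq_top {R : Type*} [CommRing R] {N : Type*} [AddCommGroup N]
    [Module R N] (I : Ideal R) (S : Submodule R N) (hgen : S ⊔ I • (⊤ : Submodule R N) = ⊤) (k : ℕ) :
    S ⊔ I ^ k • (⊤ : Submodule R N) = ⊤ := by
  induction k with
  | zero => rw [pow_zero, Ideal.one_eq_top, Submodule.top_smul]; exact sup_top_eq _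
  | succ k ih =>
    apply le_antisymm le_top
    calc (⊤ : Submodule R N) = S ⊔ I ^ k • (⊤ : Submodule R N) := ih.symm
      _ = S ⊔ I ^ k • (S ⊔ I • (⊤ : Submodule R N)) := by rw [hgen]
      _ = S ⊔ (I ^ k • S ⊔ I ^ (k + 1) • (⊤ : Submodule R N)) := by
          rw [Submodule.smul_sup, ← Submodule.mul_smul, ← pow_succ]
      _ ≤ S ⊔ I ^ (k + 1) • (⊤ : Submodule R N) :=
          sup_le le_sup_left (sup_le (le_sup_left.trans' Submodule.smul_le_right) le_sup_right)

/-! ## The lemma -/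

/-- **Compact Nakayama over `Λ₂ = ℤ_p⟦T₂⟧⟦T₁⟧`, separated form.** Let `M` be a `Λ₂`-module such that an
element lying in `𝔪^k M` for every `k` is `0` (`𝔪 = (p, T₁, T₂)`), and let `s` be a finite set with
`⟨s⟩_{Λ₂} + 𝔪M = M`. Then `⟨s⟩_{Λ₂} = M`. (Proof by compactness of the coefficient space
`(ℤ_p^{ℕ×ℕ})^s`; module docstring.) [cite: NeukirchSchmidtWingberg2008, (5.2.18)] [cite: Washington1997, Lemma 13.16] -/
theorem span_eq_top_of_separated_of_span_sup_smul_top_eq_top₂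
    (hsep : ∀ x : M, (∀ k : ℕ, x ∈ (Ideal.span {PowerSeries.C (PowerSeries.C (p : ℤ_[p])),
        (PowerSeries.X : PowerSeries (IwasawaAlgebra p)), PowerSeries.C (PowerSeries.X : IwasawaAlgebra p)} :
        Ideal (PowerSeries (IwasawaAlgebra p))) ^ k • (⊤ : Submodule (PowerSeries (IwasawaAlgebra p)) M)) → x = 0)
    (s : Finset M)
    (hgen : Submodule.span (PowerSeries (IwasawaAlgebra p)) (s : Set M) ⊔
      (Ideal.span {PowerSeries.C (PowerSeries.C (p : ℤ_[p])), (PowerSeries.X : PowerSeries (IwasawaAlgebra p)),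
        PowerSeries.C (PowerSeries.X : IwasawaAlgebra p)} : Ideal (PowerSeries (IwasawaAlgebra p))) •
        (⊤ : Submodule (PowerSeries (IwasawaAlgebra p)) M) = ⊤) :
    Submodule.span (PowerSeries (IwasawaAlgebra p)) (s : Set M) = ⊤ := by
  classical
  set 𝔪 : Ideal (PowerSeries (IwasawaAlgebra p)) := Ideal.span {PowerSeries.C (PowerSeries.C (p : ℤ_[p])),
    (PowerSeries.X : PowerSeries (IwasawaAlgebra p)), PowerSeries.C (PowerSeries.X : IwasawaAlgebra p)} with h𝔪
  refine Submodule.eq_top_iff'.mpr fun x ↦ ?_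
  let ι : Type _ := ↥s
  let v : ι → M := fun i ↦ (i : M)
  -- the element attached to a coefficient family
  let elt : (ι → ℕ → ℕ → ℤ_[p]) → M := fun c ↦
    ∑ i, (PowerSeries.mk fun j ↦ (PowerSeries.mk (c i j) : IwasawaAlgebra p)) • v i
  -- `D k = {c | x - elt c ∈ 𝔪^k M}`
  let D : ℕ → Set (ι → ℕ → ℕ → ℤ_[p]) := fun k ↦
    {c | x - elt c ∈ 𝔪 ^ k • (⊤ : Submodule (PowerSeries (IwasawaAlgebra p)) M)}
  -- non-empty
  have hne : ∀ k, (D k).Nonempty := fun k ↦ by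
    have hx : x ∈ Submodule.span (PowerSeries (IwasawaAlgebra p)) (s : Set M) ⊔
        𝔪 ^ k • (⊤ : Submodule (PowerSeries (IwasawaAlgebra p)) M) := by
      rw [sup_pow_smul_top_eq_top_of_sup_smul_top_eq_top 𝔪 _ hgen k]; exact Submodule.mem_top
    obtain ⟨y, hy, z, hz, hyz⟩ := Submodule.mem_sup.mp hx
    obtain ⟨f, -, hf⟩ := Submodule.mem_span_finset.mp hy
    refine ⟨fun i j l ↦ PowerSeries.coeff l (PowerSeries.coeff j (f i)), ?_⟩
    have hmk : ∀ i : ι, (PowerSeries.mk fun j ↦ (PowerSeries.mk fun l ↦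
        PowerSeries.coeff l (PowerSeries.coeff j (f i)) : IwasawaAlgebra p)) = f i := fun i ↦ by
      ext j l
      rw [PowerSeries.coeff_mk, PowerSeries.coeff_mk]
    have hsum : elt (fun i j l ↦ PowerSeries.coeff l (PowerSeries.coeff j (f i))) = ∑ a ∈ s, f a • a := by
      simp only [elt, hmk]
      exact Finset.sum_coe_sort s (fun a ↦ f a • a)
    simp only [D, Set.mem_setOf_eq]
    rw [hsum, hf, ← hyz, add_sub_cancel_left]
    exact hz
  -- decreasing
  have hmono : ∀ k, D (k + 1) ⊆ D k := fun k c hc ↦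
    Submodule.smul_mono_left (Ideal.pow_le_pow_right (Nat.le_succ k)) hc
  -- closed: membership depends only on the coefficients of bidegree `< (k, k)` modulo `p^k`
  have hclosed : ∀ k, IsClosed (D k) := fun k ↦ by
    rw [← isOpen_compl_iff, isOpen_iff_forall_mem_open]
    intro c hc
    refine ⟨{c' | ∀ i j l, j < k → l < k → ‖c' i j l - c i j l‖ ≤ (p : ℝ) ^ (-(k : ℤ))},
      fun c' hc' hD ↦ hc ?_, ?_, fun i j l _ _ ↦ by simp⟩
    · have hdiff := sum_mk₂_sub_sum_mk₂_mem v k (c := c') (c' := c) hc'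
      have : x - elt c = (x - elt c') + (elt c' - elt c) := by abel
      simp only [D, Set.mem_setOf_eq] at hD ⊢
      rw [this]
      exact Submodule.add_mem _ hD hdiff
    · have : {c' : ι → ℕ → ℕ → ℤ_[p] | ∀ i j l, j < k → l < k → ‖c' i j l - c i j l‖ ≤ (p : ℝ) ^ (-(k : ℤ))} =
          ⋂ i, ⋂ j ∈ Finset.range k, ⋂ l ∈ Finset.range k, (fun c' : ι → ℕ → ℕ → ℤ_[p] ↦ c' i j l) ⁻¹'
            Metric.closedBall (c i j l) ((p : ℝ) ^ (-(k : ℤ))) := by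
        ext c'
        simp only [Set.mem_setOf_eq, Set.mem_iInter, Set.mem_preimage, Metric.mem_closedBall,
          dist_eq_norm, Finset.mem_range]
        exact ⟨fun h i j hj l hl ↦ h i j l hj hl, fun h i j l hj hl ↦ h i j hj l hl⟩
      rw [this]
      refine isOpen_iInter_of_finite fun i ↦ Set.Finite.isOpen_biInter (Finset.finite_toSet _)
        fun j _ ↦ Set.Finite.isOpen_biInter (Finset.finite_toSet _) fun l _ ↦ ?_
      exact (IsUltrametricDist.isOpen_closedBall (c i j l) (zpow_ne_zero _ (by exact_mod_cast
        (Fact.out : p.Prime).ne_zero))).preimage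
          ((continuous_apply l).comp ((continuous_apply j).comp (continuous_apply i)))
  -- compactness of the coefficient space
  obtain ⟨c, hc⟩ := IsCompact.nonempty_iInter_of_sequence_nonempty_isCompact_isClosed D hmono hne
    (isCompact_univ.of_isClosed_subset (hclosed 0) (Set.subset_univ _)) hclosed
  have hx : x - elt c = 0 := hsep _ fun k ↦ Set.mem_iInter.mp hc k
  rw [sub_eq_zero] at hx
  rw [hx]
  exact Submodule.sum_mem _ fun i _ ↦ Submodule.smul_mem _ _ (Submodule.subset_span i.2)

/-- **Finite generation over `Λ₂` from `𝔪`-adic separatedness and `⟨s⟩_{Λ₂} + 𝔪M = M`** (`𝔪 = (p, T₁, T₂)`,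
`s` finite). [cite: NeukirchSchmidtWingberg2008, (5.2.18)] [cite: Washington1997, Lemma 13.16] -/
theorem module_finite_of_separated_of_span_sup_smul_top_eq_top₂
    (hsep : ∀ x : M, (∀ k : ℕ, x ∈ (Ideal.span {PowerSeries.C (PowerSeries.C (p : ℤ_[p])),
        (PowerSeries.X : PowerSeries (IwasawaAlgebra p)), PowerSeries.C (PowerSeries.X : IwasawaAlgebra p)} :
        Ideal (PowerSeries (IwasawaAlgebra p))) ^ k • (⊤ : Submodule (PowerSeries (IwasawaAlgebra p)) M)) → x = 0)
    (s : Finset M)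
    (hgen : Submodule.span (PowerSeries (IwasawaAlgebra p)) (s : Set M) ⊔
      (Ideal.span {PowerSeries.C (PowerSeries.C (p : ℤ_[p])), (PowerSeries.X : PowerSeries (IwasawaAlgebra p)),
        PowerSeries.C (PowerSeries.X : IwasawaAlgebra p)} : Ideal (PowerSeries (IwasawaAlgebra p))) •
        (⊤ : Submodule (PowerSeries (IwasawaAlgebra p)) M) = ⊤) :
    Module.Finite (PowerSeries (IwasawaAlgebra p)) M :=
  ⟨⟨s, span_eq_top_of_separated_of_span_sup_smul_top_eq_top₂ hsep s hgen⟩⟩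

/-- **The same from a finitely generated `M/𝔪M`**: if `M` is `𝔪`-adically separated and `M ⧸ 𝔪M` is a
finitely generated `Λ₂`-module (e.g. finite), then `M` is finitely generated.
[cite: NeukirchSchmidtWingberg2008, (5.2.18)] -/
theorem module_finite_of_separated_of_finite_quotient₂
    (hsep : ∀ x : M, (∀ k : ℕ, x ∈ (Ideal.span {PowerSeries.C (PowerSeries.C (p : ℤ_[p])),
        (PowerSeries.X : PowerSeries (IwasawaAlgebra p)), PowerSeries.C (PowerSeries.X : IwasawaAlgebra p)} :
        Ideal (PowerSeries (IwasawaAlgebra p))) ^ k • (⊤ : Submodule (PowerSeries (IwasawaAlgebra p)) M)) → x = 0)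
    [hq : Module.Finite (PowerSeries (IwasawaAlgebra p)) (M ⧸ (Ideal.span {PowerSeries.C (PowerSeries.C (p : ℤ_[p])),
        (PowerSeries.X : PowerSeries (IwasawaAlgebra p)), PowerSeries.C (PowerSeries.X : IwasawaAlgebra p)} :
        Ideal (PowerSeries (IwasawaAlgebra p))) • (⊤ : Submodule (PowerSeries (IwasawaAlgebra p)) M))] :
    Module.Finite (PowerSeries (IwasawaAlgebra p)) M := by
  classical
  set N := (Ideal.span {PowerSeries.C (PowerSeries.C (p : ℤ_[p])), (PowerSeries.X : PowerSeries (IwasawaAlgebra p)),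
    PowerSeries.C (PowerSeries.X : IwasawaAlgebra p)} : Ideal (PowerSeries (IwasawaAlgebra p))) •
    (⊤ : Submodule (PowerSeries (IwasawaAlgebra p)) M) with hN
  obtain ⟨t, ht⟩ := Module.Finite.fg_top (R := PowerSeries (IwasawaAlgebra p)) (M := M ⧸ N)
  -- lift the generators
  obtain ⟨s, hs⟩ : ∃ s : Finset M, s.image (N.mkQ) = t := by
    refine ⟨t.image (fun y ↦ (N.mkQ_surjective y).choose), ?_⟩
    rw [Finset.image_image]
    conv_rhs => rw [← Finset.image_id (s := t)]
    refine Finset.image_congr fun y _ ↦ ?_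
    exact (N.mkQ_surjective y).choose_spec
  refine module_finite_of_separated_of_span_sup_smul_top_eq_top₂ hsep s ?_
  -- `⟨s⟩ ⊔ N = ⊤` because `⟨s⟩` maps onto `M/N`
  have hmap : (Submodule.span (PowerSeries (IwasawaAlgebra p)) (s : Set M)).map N.mkQ = ⊤ := by
    rw [Submodule.map_span, ← Finset.coe_image, hs, ht]
  have hcm := Submodule.comap_map_eq N.mkQ (Submodule.span (PowerSeries (IwasawaAlgebra p)) (s : Set M))
  rw [hmap, Submodule.comap_top, Submodule.ker_mkQ] at hcm
  exact hcm.symm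

end Literature.NumberTheory.EllipticCurves

end
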